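/-
Origin: expansion seat `prover-pub-hodgecm-mc-binder-1-g17-0`, handover #93r2 2026-08-20T22:31:33Z md5 ad3b82be9c12 (128 l.; REPLACE of HodgeCM/Model/HsmallOfTowerAtLiftType.lean — PKG file now debe92eb600b (132 l., incl. packager Origin header); body of record 10c5cc5b5e86 (128 l.) → ad3b82be9c12; owner binder-2 #93 (RUN 64) — CONSENT: binder-2-g18 STATUS l.14543; token strike only (18 tokens); NAMES for audit: HodgeCM.Model.hsmall_of_tower_at_of_liftTyped · HodgeCM.Model.hsmall_of_tower_at_of_typeOf) (`HOME/mc/pub-hodgecm-mc-binder-1-g17/campaign/new/HsmallOfTowerAtLiftType.lean`, md5 ad3b82be9c12, 128 lines);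
landed by the gen-27 packager (p-g27) in gate run 65 REPLACES the earlier landed copy of `HodgeCM/Model/HsmallOfTowerAtLiftType.lean` (verbatim).
-/
/-
Copyright (c) 2026 the pub-hodgecm formalisation cell (harness21).  New file, not vendored.
Origin: session prover-pub-hodgecm-mc-binder-2-g18-0 (unit pub-hodgecm-mc-binder-2-g18, BINDER PROVER gen 18 of lineage mc-binder-2;
content lane (J-Liu-Θ), (J4a-socket) POINTWISE — E's `hsmall` through the tower in ONE call with clauses 1–2 of `hJ` discharged
from the (J4a) typing), 2026-08-20.  Intended final place: `HodgeCM/Model/HsmallOfTowerAtLiftType.lean` (NEW additive leaf;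
imports binder-1-g17's #R120 `Model/HsmallOfTowerAt` and binder-2-g18's #92 `Model/Binders/JLiuHJOfLiftType` (both RUN 64);
nothing imports it).
-/
import Summits.HodgeConjecture.HodgeCM.Model.HsmallOfTowerAt
import Summits.HodgeConjecture.HodgeCM.Model.Binders.JLiuHJOfLiftType

set_option autoImplicit false

/-!
# E's `hsmall` through the tower, POINTWISE, with clauses 1–2 of `hJ` from the (J4a) typing

binder-1's `hsmall_of_tower_at` (#R120; the shape E's lambda calls, with `R := thetaModelOf (orientBitι L ι₁) …` per point) takes
`hJ : ∃ S, (∀ μ ∈ S, PhiMu μ) ∧ (∀ μ ∈ S, ∀ d, adm μ d → d.IsCorner c.K (c.Ψ i) c.σ) ∧ hfam S`.  With the dictionary's `PhiMu` ∕ `adm`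
READ OFF a type map `typeOf : Char → CMType L` (`hPhi`, `hadm` — definitional for `PhiMu μ := ι₁ ∈ typeOf μ`,
`adm μ d := d.IsReflexOfTypeG ι₁ (typeOf μ)`), binder-2's pointwise socket `hJ_at_of_liftTyped` (#92) turns the (J4a)-typed datum

  `hJ4 : ∃ S, (∀ μ ∈ S, ∃ j, ι₁.comp j = c.σ ∧ typeOf μ = liftType false c.K L j ι₁ (c.Ψ i)) ∧ hfam S`

into that `hJ`, using the guard's `c.σ ∈ Ψ_i` (`hgood.mem i`) and E's scope conjunction `h6` (both already bound in E's row).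
This leaf is the composite, so that the junction-form child of E (glue-1-g11's draft «T», STATUS 21:50:37Z) can bind ONE family
`typeOf` in place of the two `PhiMu`, `adm`, and the (J4a) clause in place of clauses 1–2 of `hJ`:

  `hsmall := fun V c hc h6 hcan i => hsmall_of_tower_at_of_liftTyped … (hcite V) hc h6 i (hJ4 V c hc h6 hcan i)`.

KERNEL: 2 theorems; 0 records, nothing cited, no `def … : Prop`; expected `#print axioms` ⊆ {propext, Classical.choice, Quot.sound}.
-/

noncomputable section

open Function Set
open NumberField
open Literature.AlgebraicGeometry.Motives
open Literature.AlgebraicGeometry.ShimuraVarieties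
open Literature.AlgebraicGeometry.HodgeTheory
open Literature.NumberTheory.Automorphic
open Literature.NumberTheory.Automorphic.PicardCM
open Literature.NumberTheory.Transcendental (Arapura2012_Cor_15_4_6)

namespace HodgeCM.Model

open HodgeCM.Model.TowerLevel HodgeCM.Model.TowerCarrier HodgeCM.Literature.Theta HodgeCM.Literature.Theta.LiuAlbaneseModuleDatum
open HodgeCM.CMTypeOps (inflate)
open HodgeCM.Universe (ThetaModel)
open HodgeCM.SignRecipe (liftType)

variable (hHD : exists_isReal_hodgeModel) (hI : hodgePQ_independent_of_hodgeModel)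
  (h₁ : BallQuotientUniformised) (h₃ : CMAbelianVarietyRealised)

/-- **E's `hsmall` THROUGH THE TOWER, POINTWISE, (J4a)-typed.**  One theta model `R`, one `(L, ι₁, V, c, i)`: from the cited
sentences for the tower dictionary at `V` whose `PhiMu` ∕ `adm` are read off `typeOf` (`hPhi`, `hadm`), a good context, E's scope
conjunction `h6`, and a finite set `S` of characters each (J4a)-typed at the corner `(c, i)` and carrying (J4) families of component
classes for `R.Theta V c i Γ` at the tower's levels: the `hsmall` clause of E at that point. -/
theorem hsmall_of_tower_at_of_liftTyped (hR : DeligneMilne1982_Thm_6_20_full) (hA : Arapura2012_Cor_15_4_6)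
    (R : (picardCMUniverse hHD hI h₁ h₃).ThetaModel)
    {L : CMField} {ι₁ : L →+* ℂ} (V : HermSpace3 L ι₁) (c : SeesawCtx L)
    (Char : Type) (Adm : Char → Type) (Ω : (μ : Char) → Adm μ → Type)
    [∀ μ a, AddCommGroup (Ω μ a)] [∀ μ a, Module ℂ (Ω μ a)] [∀ μ a, Module (adelicAlgebra V) (Ω μ a)]
    [∀ μ a, IsScalarTower ℂ (adelicAlgebra V) (Ω μ a)] (PhiMu : Char → Prop) (adm : Char → LiuCMSide → Prop)
    (typeOf : Char → CMType L)
    (hPhi : ∀ μ, ι₁ ∈ (typeOf μ).1 → PhiMu μ) (hadm : ∀ μ d, adm μ d → d.IsReflexOfTypeG ι₁ (typeOf μ))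
    (hcite : (LiuDictionary.ofTower hHD hI h₁ h₃ hA V Char Adm Ω PhiMu adm).Irreducible ∧
      (LiuDictionary.ofTower hHD hI h₁ h₃ hA V Char Adm Ω PhiMu adm).Prop413 ∧
      (LiuDictionary.ofTower hHD hI h₁ h₃ hA V Char Adm Ω PhiMu adm).Thm418_2 ∧
      (LiuDictionary.ofTower hHD hI h₁ h₃ hA V Char Adm Ω PhiMu adm).MuSeparated ∧
      (LiuDictionary.ofTower hHD hI h₁ h₃ hA V Char Adm Ω PhiMu adm).Thm418C)
    (hgood : R.GoodCtx ι₁ c)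
    (h6 : Module.finrank ℚ c.K = 6 ∧ IsNormalClosure ℚ c.K L ∧ (Module.finrank ℚ L = 24 ∨ Module.finrank ℚ L = 48))
    (i : Fin 4)
    (hJ4 : ∃ S : Finset Char,
        (∀ μ ∈ S, ∃ j : c.K →+* L, ι₁.comp j = c.σ ∧ typeOf μ = liftType false c.K L j ι₁ (c.Ψ i)) ∧
        ∀ (Γ : Level V) (hΓ : Γ.BelowConjThree), ∀ ω ∈ R.Theta V c i Γ,
          ∃ cf : towerLevel hHD hI (ballQuotientUniformisedDatum_of h₁) h₃ hA Γ hΓ,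
            TowerLevel.res hHD hI (ballQuotientUniformisedDatum_of h₁) h₃ hA cf = ω ∧
              (ofLevel hHD hI (ballQuotientUniformisedDatum_of h₁) h₃ hA Γ hΓ cf :
                  (LiuDictionary.ofTower hHD hI h₁ h₃ hA V Char Adm Ω PhiMu adm).H) ∈
                ⨆ μ ∈ S, (LiuDictionary.ofTower hHD hI h₁ h₃ hA V Char Adm Ω PhiMu adm).block μ) :
    ∃ Γ₀ : Level V, ∀ Γ ≤ Γ₀,
      ∃ (M : CMField) (k : c.K →+* M) (σ' : M →+* ℂ), σ'.comp k = c.σ ∧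
        R.Theta V c i Γ ⊆ (picardCMUniverse hHD hI h₁ h₃).Uiso Γ M (inflate k (c.Ψ i)) σ' :=
  hsmall_of_tower_at hHD hI h₁ h₃ hR hA R V c Char Adm Ω PhiMu adm hcite hgood i
    (hJ_at_of_liftTyped PhiMu adm typeOf hPhi hadm (hgood.mem i) h6 _ hJ4)

/-- **… with `PhiMu` and `adm` DEFINED from `typeOf`** (`PhiMu μ := ι₁ ∈ typeOf μ`, `adm μ d := d.IsReflexOfTypeG ι₁ (typeOf μ)` —
the instance of axioms-1-g15's `liuDictionaryOfWeil` once its `PhiMu` is pinned so): the two read-off hypotheses vanish and the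
junction-form child of E binds the single family `typeOf` in place of `PhiMu`, `adm`. -/
theorem hsmall_of_tower_at_of_typeOf (hR : DeligneMilne1982_Thm_6_20_full) (hA : Arapura2012_Cor_15_4_6)
    (R : (picardCMUniverse hHD hI h₁ h₃).ThetaModel)
    {L : CMField} {ι₁ : L →+* ℂ} (V : HermSpace3 L ι₁) (c : SeesawCtx L)
    (Char : Type) (Adm : Char → Type) (Ω : (μ : Char) → Adm μ → Type)
    [∀ μ a, AddCommGroup (Ω μ a)] [∀ μ a, Module ℂ (Ω μ a)] [∀ μ a, Module (adelicAlgebra V) (Ω μ a)]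
    [∀ μ a, IsScalarTower ℂ (adelicAlgebra V) (Ω μ a)] (typeOf : Char → CMType L)
    (hcite : (LiuDictionary.ofTower hHD hI h₁ h₃ hA V Char Adm Ω (fun μ => ι₁ ∈ (typeOf μ).1)
        (fun μ d => d.IsReflexOfTypeG ι₁ (typeOf μ))).Irreducible ∧
      (LiuDictionary.ofTower hHD hI h₁ h₃ hA V Char Adm Ω (fun μ => ι₁ ∈ (typeOf μ).1)
        (fun μ d => d.IsReflexOfTypeG ι₁ (typeOf μ))).Prop413 ∧
      (LiuDictionary.ofTower hHD hI h₁ h₃ hA V Char Adm Ω (fun μ => ι₁ ∈ (typeOf μ).1)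
        (fun μ d => d.IsReflexOfTypeG ι₁ (typeOf μ))).Thm418_2 ∧
      (LiuDictionary.ofTower hHD hI h₁ h₃ hA V Char Adm Ω (fun μ => ι₁ ∈ (typeOf μ).1)
        (fun μ d => d.IsReflexOfTypeG ι₁ (typeOf μ))).MuSeparated ∧
      (LiuDictionary.ofTower hHD hI h₁ h₃ hA V Char Adm Ω (fun μ => ι₁ ∈ (typeOf μ).1)
        (fun μ d => d.IsReflexOfTypeG ι₁ (typeOf μ))).Thm418C)
    (hgood : R.GoodCtx ι₁ c)
    (h6 : Module.finrank ℚ c.K = 6 ∧ IsNormalClosure ℚ c.K L ∧ (Module.finrank ℚ L = 24 ∨ Module.finrank ℚ L = 48))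
    (i : Fin 4)
    (hJ4 : ∃ S : Finset Char,
        (∀ μ ∈ S, ∃ j : c.K →+* L, ι₁.comp j = c.σ ∧ typeOf μ = liftType false c.K L j ι₁ (c.Ψ i)) ∧
        ∀ (Γ : Level V) (hΓ : Γ.BelowConjThree), ∀ ω ∈ R.Theta V c i Γ,
          ∃ cf : towerLevel hHD hI (ballQuotientUniformisedDatum_of h₁) h₃ hA Γ hΓ,
            TowerLevel.res hHD hI (ballQuotientUniformisedDatum_of h₁) h₃ hA cf = ω ∧
              (ofLevel hHD hI (ballQuotientUniformisedDatum_of h₁) h₃ hA Γ hΓ cf :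
                  (LiuDictionary.ofTower hHD hI h₁ h₃ hA V Char Adm Ω (fun μ => ι₁ ∈ (typeOf μ).1)
                    (fun μ d => d.IsReflexOfTypeG ι₁ (typeOf μ))).H) ∈
                ⨆ μ ∈ S, (LiuDictionary.ofTower hHD hI h₁ h₃ hA V Char Adm Ω (fun μ => ι₁ ∈ (typeOf μ).1)
                  (fun μ d => d.IsReflexOfTypeG ι₁ (typeOf μ))).block μ) :
    ∃ Γ₀ : Level V, ∀ Γ ≤ Γ₀,
      ∃ (M : CMField) (k : c.K →+* M) (σ' : M →+* ℂ), σ'.comp k = c.σ ∧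
        R.Theta V c i Γ ⊆ (picardCMUniverse hHD hI h₁ h₃).Uiso Γ M (inflate k (c.Ψ i)) σ' :=
  hsmall_of_tower_at_of_liftTyped hHD hI h₁ h₃ hR hA R V c Char Adm Ω (fun μ => ι₁ ∈ (typeOf μ).1)
    (fun μ d => d.IsReflexOfTypeG ι₁ (typeOf μ)) typeOf (fun _ h => h) (fun _ _ h => h) hcite hgood h6 i hJ4

end HodgeCM.Model

end
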